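import Literature.MathematicalPhysics.QuantumFieldTheory.Balaban1983to89.T4HistoryLipschitzRecursion
import Summits.QuantumFields.BalabanUV.T4Continuum.Support.NE9Lemma1Gather

/-!
# NE9Lemma1Counting — leaf S5 (the fading SOURCE of the NE9 frame) for channels of the printed (1.23)/(1.33)-PIECE FORM:
# `ChannelSizeAtStepNN` with the geometric profile `τ k j = (6L)⁴·L^{j−k}` (ω = L⁻¹) from ONE displayed per-piece bound of the
# (1.24)×(1.25) shape and the level counts of [II] p. 8, via `NE9Lemma1Gather.gather_atStep`
# (cell `pub-balaban`, T4-DAG §2 node U3 / §6 NE9; lineage t4-ne9-p1 = row NE9 OWNER, generation 23; part 2 of 3)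

HONEST FRAMING (T4-DAG PAGE 1).  Rung (B)+1 of the FINITE-VOLUME T⁴ programme — existence AND uniqueness of the ε → 0 limit
of gauge-invariant observables on a fixed torus; NOT infinite volume, NOT a mass gap, NOT the Clay problem.  NE9
(`T4OutputRate.NE9` ∧ `FadingMemory`) is a cell NEW ESTIMATE, NOT PRINTED, and is NOT discharged here; spine 0/9 unchanged.
HONEST DEPENDENCY (cell line, verbatim): continuum YM on T⁴ ⇐ BetaPertH ∧ nine spine estimates (0/9 proved); BetaPertH ⇐ (D1)
∧ (D4) ∧ CAP+tail; G-an2-4 gates asym, D1 and NE2/3/4.  `FlowStep.BetaPertH`, (B), (B^μ) do not occur in this module.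
[I] = [Balaban1987RG1] (CMP **109**), [II] = [Balaban1988RG2Cluster] (CMP **116**) are quoted for TYPES only (ABSOLUTE RULE:
nothing printed in the audited series is asserted).

WHERE THIS SITS (skeleton `t4/b2b-balaban-t4-ne9-p1/SKELETON-NE9-P1.md` v1.3.3 §3 row S5).  The NE9 frame's END
(`NE9LastCouplingBridge.ne9_and_fadingMemory_of_couplingTwoPoint` and its faces `…_vacSub_sizeInduction(_compProj)`) displays,
about the step-k localization channel `T` (old terms ↦ localized fluctuation potentials, [II] (1.33) p. 9), the PER-CREATION-STEP
size binder `T4HistoryLipschitzRecursion.ChannelSizeAtStepNN Adm T κ wt τ` with the profile binders `hτ : τ k j ≤ τ̄·ω^{k−j}`,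
`hω : 0 ≤ ω` — the ONLY source of the fading factor (skeleton C4).  Its printed TYPE is [II] Lemma 1 read BEFORE the sum over
the creation step j (p. 8 l. 9–10: *"To bound the first sum, over □′ ⊂ □̃², we use the factor (L^jη)⁵ in (1.24). This yields
(6L)⁴L^jη, and the sum over j is bounded by 2(6L)⁴."*).  The arithmetic of Lemma 1's proof is kernel-certified in the tree
module `B13Sect1Arith` (unit pv20), re-run at ONE creation step in `NE9Lemma1Gather.gather_atStep` (part 1).  THIS FILE:
* §1 the PIECE FORM of a channel (`PieceData`, `pieceChannel`): `T k s H y = Σ_{j≤k} Σ_{□₀} Σ_{Y₀} Σ_{X ∈ 𝐃_j-sources}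
  piece(k,s,y,□₀,Y₀,X)(U ↦ H U X)`, every piece an ADDITIVE functional of the old term's values on its own domain (print: (1.23)
  p. 7 is a contour integral of the term EVALUATED at parameter-dependent configurations — linear; *"It is a sum over all
  admissible □₀, Y₀, j and X"*); the STRUCTURE binders `ChannelAdditive` (any class), `ChannelLocal`, `ChannelStepSum` of
  `T4HistoryLipschitzRecursion` are PROVED for it;
* §2 **`channelSizeAtStepNN_piece`**: `ChannelSizeAtStepNN Adm (pieceChannel P) κ wt τ` on ANY class with
  `wt k y = Kp k y·O1·e·exp(⅛κ₁d₀)·exp(−(1/16)κ₁·d_k(Y))` (print's (1.29) weight per unit of E₀) and **`τ k j = (6L)⁴·ℓ k j`**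
  from ONE displayed per-piece bound `PieceBound` of the (1.24)×(1.25) shape (LINEAR in the input family's size `N`) and the
  level counts `LevelCounts` ((1.26), the □′-cover and □′-count, (1.27), (1.28) — the paper's numerals, hypotheses as in
  `B13Sect1Arith.gather_129`);
* §3 the PROFILE: with the printed factor `ℓ k j = L^j·(L^k)⁻¹` (= L^jη, η = L^{−k}), `τ k j = (6L)⁴·(L⁻¹)^{k−j}` for `j ≤ k`
  (`tau_eq_geometric`) — so the END's `hτ`, `hω`, `hτbar` hold with `τ̄ = (6L)⁴`, `ω = L⁻¹ < 1` for `L > 1`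
  (`profile_of_pieceForm`, `channelSizeAtStepNN_piece_printed`), and `Σ_{j≤k} τ k j ≤ 2(6L)⁴` is print's j-summed constant
  (`sum_tau_le` = `B13Sect1Arith.jsum_le`) — what the STATEMENT (1.36) keeps and the per-step profile it forgets (record E37).
Part 3 (`NE9Lemma1CountingEval`) joins this with P2's leaf `NE9EvaluationChannel` (kernel-mass form) and gives a toy witness.

WHAT REMAINS DISPLAYED, AND ITS STANDING.  `PieceBound` — every localized piece of the step-k curly bracket of a scale-j input
family of size `N·e^{−κd_j}` is bounded by `Kp·N·ℓ_j⁵·e^{−κd_j(X)}·exp(−⅛(κ₁−1)d_k(Y) + ⅛κ₁d_k(□₀) − ½(κ₁−1)M⁻⁴|Y₀∖□̃⁴|)` —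
is the (1.24)×(1.25) shape: PRINTED for the DISPLAYED family (the last term of (I.3.34), via (I.3.54) of [I]; `Kp` ↔
8B₀C₁e^{16κ₁}α₂⁻¹ε₁(α₁/α₃)⁵ once the cut-off replaces g_k|B| by ε₁ — p. 8 *"Another possibility is to use the expression g_k|B|
instead of ε₁"*), asserted for the remaining families by the printed ANALOGY p. 8 ¶2 (*"almost all of them are quite general and
can be applied to all terms in the fluctuation field action … using the inequalities (I.4.5), (I.4.22), (I.4.36), (I.5.44)"*) —
PROOF-INTERIOR of [I] §§3–5, class (R-2) of the cell's residual ledger, NOT a printed statement and NOT proved here.  CAVEAT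
(skeleton C5, GAPS O-ne9p1g22-1): the ℓ_j⁵-gain is the irrelevance mechanism of [I] p. 258 for the MARGINAL-FREE packages
(0.28)–(0.29); for the bare curly bracket of a marginal input (c·A_□) `PieceBound` is FALSE — a `PieceData` satisfying it models
the channel `𝒯 ∘ P` of the skeleton's dictionary (or 𝒯 on the marginal-free class), never the bare 𝒯 on all analytic families.
d₀ = d_k(□₀) is kept as a parameter.  DISGUISE TEST: every statement concerns ONE input family `H` and ONE history `s`; nothing
compares two histories — S5 is the fading source, not NE9 (`T4HistoryLipschitzWitness`).

References (TYPES only): T. Bałaban, *Renormalization group approach to lattice gauge field theories. II. Cluster expansions*,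
Commun. Math. Phys. **116**, 1–22 (1988) [Balaban1988RG2Cluster], (1.23)–(1.29) pp. 7–8, Lemma 1 (1.33)–(1.36) p. 9 (renders
`b2b-balaban-ref1/pages/1988-cmp116-rg-II-cluster/…-p004/p007/p008-x2.png` re-read as images by this seat, 2026-08-20);
T. Bałaban, *Renormalization group approach to lattice gauge field theories. I*, Commun. Math. Phys. **109**, 249–301 (1987)
[Balaban1987RG1], (0.23) p. 256, (0.28)–(0.29) p. 258, (3.54) p. 280.  Summits-side NEW work (LEAN PLACEMENT RULE); imports
`T4HistoryLipschitzRecursion` (the binders) and part 1; modifies nothing; 0 sorry.  Value = kernel bookkeeping turning leaf S5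
from a SUPPORTED reading into «KERNEL at FORM level modulo ONE displayed per-piece bound», NOT summit progress.
-/

noncomputable section

namespace Summit.QuantumFields.BalabanUV.T4Continuum.NE9Lemma1Counting

open scoped BigOperators
open Literature.MathematicalPhysics.QuantumFieldTheory.Balaban1983to89
open Literature.MathematicalPhysics.QuantumFieldTheory.Balaban1983to89.T4OutputRate
open Literature.MathematicalPhysics.QuantumFieldTheory.Balaban1983to89.T4HistoryLipschitzRecursion
open Summit.QuantumFields.BalabanUV.T4Continuum.NE9Lemma1Gather (sum_le_sum_sum_of_cover gather_atStep)

/-! ## §1 The PIECE FORM of a localization channel and its structure binders -/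

variable {C : Carriers} {Bg ι α β γ : Type}

/-- **THE PIECE DATA of a channel of the printed (1.23)/(1.33)-FORM** (no inequality inside).  At step `k`, output index `y`
(↔ (Y, U, B′) of 𝐕′_k(Y,·)): the boxes □₀ ⊂ Y (`S0 k y`), the connected domains Y₀ ∋ □̃⁴ (`SY k y □₀`), for every creation
step `j` the SOURCE domains X ∈ 𝐃_j of the pieces (`src k y □₀ j`; print: *"X∈𝐃_j, X ⊂ □̃²"*), the counting cubes □′ ∈ π_j,
□′ ⊂ □̃² (`Sq k y □₀ j`) with their fibres X ⊃ □′ (`SX k y □₀ j □′`), the volumes M⁻⁴|Y₀∖□̃⁴| (`vol k y □₀ Y₀`), the tree length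
d_k(Y) of the output (`dY k y`), and THE PIECES: for (k, s, y, □₀, Y₀, X) an ADDITIVE functional of the old term's values
`U ↦ H U X` on its own domain — the contour integral (1.23) p. 7 of the term EVALUATED at parameter-dependent configurations,
*"It is a sum over all admissible □₀, Y₀, j and X"* (p. 7).  The coupling history `s` enters the pieces only (through B′).
[cite: Balaban1988RG2Cluster, (1.23) p.7, (1.33) p.9] -/
structure PieceData (C : Carriers) (Bg ι α β γ : Type) where
  /-- boxes □₀ ⊂ Y -/
  S0 : ℕ → ι → Finset α
  /-- connected domains Y₀ ∋ □̃⁴, given □₀ -/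
  SY : ℕ → ι → α → Finset β
  /-- source domains X ∈ 𝐃_j of the pieces, given □₀ and the creation step j -/
  src : ℕ → ι → α → ℕ → Finset C.Dom
  /-- counting cubes □′ ∈ π_j, □′ ⊂ □̃² -/
  Sq : ℕ → ι → α → ℕ → Finset γ
  /-- the fibre X ∈ 𝐃_j, X ⊃ □′ -/
  SX : ℕ → ι → α → ℕ → γ → Finset C.Dom
  /-- M⁻⁴|Y₀∖□̃⁴| -/
  vol : ℕ → ι → α → β → ℝ
  /-- d_k(Y) of the output index -/
  dY : ℕ → ι → ℝ
  /-- the localized piece: an additive functional of the old term's values on its domain -/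
  piece : ℕ → (ℕ → ℝ) → ι → α → β → C.Dom → ((Bg → ℝ) →+ ℝ)

/-- **THE CHANNEL OF THE PIECE FORM**: `T k s H y = Σ_{j≤k} Σ_{□₀} Σ_{Y₀} Σ_{X ∈ src} piece(k,s,y,□₀,Y₀,X)(U ↦ H U X)` —
(1.33) p. 9 as the sum of the pieces (1.23) p. 7 over *"all admissible □₀, Y₀, j and X"*. [cite: Balaban1988RG2Cluster, (1.33) p.9] -/
def pieceChannel (P : PieceData C Bg ι α β γ) : ℕ → (ℕ → ℝ) → (Bg → C.Dom → ℝ) → ι → ℝ :=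
  fun k s H y => ∑ j ∈ Finset.range (k + 1), ∑ a ∈ P.S0 k y, ∑ b ∈ P.SY k y a,
    ∑ x ∈ P.src k y a j, P.piece k s y a b x (fun U => H U x)

/-- The one-creation-step block of the channel: the pieces with sources of creation step `j`. [folklore] -/
def stepBlock (P : PieceData C Bg ι α β γ) (k : ℕ) (s : ℕ → ℝ) (H : Bg → C.Dom → ℝ) (y : ι) (j : ℕ) : ℝ :=
  ∑ a ∈ P.S0 k y, ∑ b ∈ P.SY k y a, ∑ x ∈ P.src k y a j, P.piece k s y a b x (fun U => H U x)

/-- The channel is the sum of its one-step blocks over `j ≤ k`. [folklore] -/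
theorem pieceChannel_eq_sum_stepBlock (P : PieceData C Bg ι α β γ) (k : ℕ) (s : ℕ → ℝ) (H : Bg → C.Dom → ℝ) (y : ι) :
    pieceChannel P k s H y = ∑ j ∈ Finset.range (k + 1), stepBlock P k s H y j := rfl

/-- **`ChannelAdditive` FOR THE PIECE FORM, on ANY class** (each piece is additive; finite sums). [folklore] -/
theorem channelAdditive_piece (P : PieceData C Bg ι α β γ) (Adm : Set (Bg → C.Dom → ℝ)) :
    ChannelAdditive Adm (pieceChannel P) := by
  intro k s H₁ _ H₂ _ y
  simp only [pieceChannel]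
  rw [← Finset.sum_sub_distrib]
  refine Finset.sum_congr rfl fun j _ => ?_
  rw [← Finset.sum_sub_distrib]
  refine Finset.sum_congr rfl fun a _ => ?_
  rw [← Finset.sum_sub_distrib]
  refine Finset.sum_congr rfl fun b _ => ?_
  rw [← Finset.sum_sub_distrib]
  refine Finset.sum_congr rfl fun x _ => ?_
  have hfun : (fun U => (H₁ - H₂) U x) = (fun U => H₁ U x) - fun U => H₂ U x := by
    funext U; simp only [Pi.sub_apply]
  rw [hfun, map_sub]

/-- SOURCE DISCIPLINE (printed structure, [I] (0.23) p. 256 / [II] p. 7): the sources listed under the creation step `j` ARE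
domains of creation step `j`. [cite: Balaban1988RG2Cluster, (1.23) p.7] -/
def SrcScale (P : PieceData C Bg ι α β γ) : Prop :=
  ∀ (k : ℕ) (y : ι) (a : α) (j : ℕ), ∀ x ∈ P.src k y a j, C.scale x = j

/-- On a block of creation step `j`, restricting the input family to the creation step `j′` keeps the block if `j = j′` and
kills it otherwise. [folklore] -/
theorem stepBlock_restrictScale {P : PieceData C Bg ι α β γ} (hsrc : SrcScale P) (k : ℕ) (s : ℕ → ℝ)
    (H : Bg → C.Dom → ℝ) (y : ι) (j j' : ℕ) :
    stepBlock P k s (restrictScale j' H) y j = if j = j' then stepBlock P k s H y j else 0 := by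
  by_cases hjj : j = j'
  · rw [if_pos hjj]
    simp only [stepBlock]
    refine Finset.sum_congr rfl fun a _ => Finset.sum_congr rfl fun b _ => Finset.sum_congr rfl fun x hx => ?_
    have hx' : C.scale x = j' := (hsrc k y a j x hx).trans hjj
    have hfun : (fun U => restrictScale j' H U x) = fun U => H U x := by
      funext U; exact restrictScale_of_eq H hx'
    rw [hfun]
  · rw [if_neg hjj]
    simp only [stepBlock]
    refine Finset.sum_eq_zero fun a _ => Finset.sum_eq_zero fun b _ => Finset.sum_eq_zero fun x hx => ?_
    have hx' : C.scale x ≠ j' := fun h => hjj ((hsrc k y a j x hx).symm.trans h)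
    have hfun : (fun U => restrictScale j' H U x) = 0 := by
      funext U; exact restrictScale_of_ne H hx'
    rw [hfun, map_zero]

/-- The channel applied to the one-step restriction `restrictScale j′ H` is the block of creation step `j′` (zero if `j′ > k`).
[folklore] -/
theorem pieceChannel_restrictScale {P : PieceData C Bg ι α β γ} (hsrc : SrcScale P) (k : ℕ) (s : ℕ → ℝ)
    (H : Bg → C.Dom → ℝ) (y : ι) (j' : ℕ) :
    pieceChannel P k s (restrictScale j' H) y = if j' ∈ Finset.range (k + 1) then stepBlock P k s H y j' else 0 := by
  rw [pieceChannel_eq_sum_stepBlock]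
  simp_rw [stepBlock_restrictScale hsrc]
  rw [Finset.sum_ite_eq']

/-- **`ChannelStepSum` FOR THE PIECE FORM, on ANY class** (the channel is the sum over the creation steps of its outputs on
the one-step sub-families — (1.33) p. 9 sums the pieces (1.23) over j). [cite: Balaban1988RG2Cluster, (1.33) p.9] -/
theorem channelStepSum_piece {P : PieceData C Bg ι α β γ} (hsrc : SrcScale P) (Adm : Set (Bg → C.Dom → ℝ)) :
    ChannelStepSum Adm (pieceChannel P) := by
  intro k s H _ y
  rw [pieceChannel_eq_sum_stepBlock]
  refine Finset.sum_congr rfl fun j hj => ?_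
  rw [pieceChannel_restrictScale hsrc, if_pos hj]

/-- **`ChannelLocal` FOR THE PIECE FORM, on ANY class** (the step-k channel reads only the creation steps ≤ k — [I] (0.23)
p. 256: the old action at step k consists of the terms created at steps ≤ k). [cite: Balaban1987RG1, (0.23) p.256] -/
theorem channelLocal_piece {P : PieceData C Bg ι α β γ} (hsrc : SrcScale P) (Adm : Set (Bg → C.Dom → ℝ)) :
    ChannelLocal Adm (pieceChannel P) := by
  intro k s H _ y
  simp only [pieceChannel]
  refine Finset.sum_congr rfl fun j hj => Finset.sum_congr rfl fun a _ => Finset.sum_congr rfl fun b _ =>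
    Finset.sum_congr rfl fun x hx => ?_
  have hjk : C.scale x ≤ k := by
    rw [hsrc k y a j x hx]; exact Nat.lt_succ_iff.mp (Finset.mem_range.mp hj)
  have hfun : (fun U => truncScale k H U x) = fun U => H U x := by
    funext U; simp only [truncScale, if_pos hjk]
  rw [hfun]

/-- For an input family SUPPORTED at the creation step `j ≤ k`, the channel output IS the step-j block. [folklore] -/
theorem pieceChannel_of_supported {P : PieceData C Bg ι α β γ} (hsrc : SrcScale P) {k j : ℕ} (hjk : j ≤ k)
    (s : ℕ → ℝ) {H : Bg → C.Dom → ℝ} (hsupp : ∀ (U : Bg) (X : C.Dom), C.scale X ≠ j → H U X = 0) (y : ι) :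
    pieceChannel P k s H y = stepBlock P k s H y j := by
  have hH : restrictScale j H = H := by
    funext U X
    by_cases h : C.scale X = j
    · exact restrictScale_of_eq H h
    · rw [restrictScale_of_ne H h, hsupp U X h]
  have h1 := pieceChannel_restrictScale hsrc k s H y j
  rw [hH, if_pos (Finset.mem_range.mpr (Nat.lt_succ_of_le hjk))] at h1
  exact h1

/-! ## §2 The per-creation-step size binder `ChannelSizeAtStepNN` from ONE displayed per-piece bound -/

/-- **THE DISPLAYED PER-PIECE BOUND (1.24)×(1.25)** (binder; PROOF-INTERIOR of [I] §§3–5 — (I.3.54) for the displayed family,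
(I.4.5), (I.4.22), (I.4.36), (I.5.44) for the others by the printed analogy [II] p. 8 ¶2; NOT a printed statement, NOT proved
here): at step `k`, output `y`, box □₀ = `a`, domain Y₀ = `b`, creation step `j`, source X = `x`, for every function `f` of the
background with `|f U| ≤ e^{−κd(X)}·N` (`N ≥ 0`; in the application `f = U ↦ H U X` for an input family of size N at scale j),
the piece is bounded by `Kp k y · N · ℓ k j⁵ · e^{−κd(X)} · exp(−⅛(κ₁−1)d_k(Y) + ⅛κ₁d₀ − ½(κ₁−1)·vol)` — verbatim the shape of
(1.24) p. 7 (*"|(1.23)| ≦ 8B₀C₁e^{16κ₁}α₂⁻¹g_k|B|E₀(α₁/α₃)⁵(L^jη)⁵·exp(−(κ₁−1)M⁻⁴|Y₀∖□̃⁴|)exp(−κd_j(X))"*) supplemented by (1.25)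
(*"exp(−⅛(κ₁−1)d_k(Y) + ⅛κ₁d_k(□₀) − ½(κ₁−1)M⁻⁴|Y₀∖□̃⁴|)"*), LINEAR in the size (E₀ ↦ N) and uniform in the history `s` (print
replaces g_k|B| by ε₁ on the cut-off).  CAVEAT (GAPS O-ne9p1g22-1): false for the bare curly bracket of a marginal input —
the ℓ⁵-gain is [I] p. 258's mechanism for marginal-free packages. [cite: Balaban1988RG2Cluster, (1.24)-(1.25) p.7] -/
def PieceBound (P : PieceData C Bg ι α β γ) (κ κ₁ d0 : ℝ) (Kp : ℕ → ι → ℝ) (ℓ : ℕ → ℕ → ℝ) : Prop :=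
  ∀ (k : ℕ) (s : ℕ → ℝ) (y : ι), ∀ a ∈ P.S0 k y, ∀ b ∈ P.SY k y a, ∀ (j : ℕ), ∀ x ∈ P.src k y a j,
    ∀ (f : Bg → ℝ) (N : ℝ), 0 ≤ N → (∀ U : Bg, |f U| ≤ Real.exp (-(κ * C.d x)) * N) →
      |P.piece k s y a b x f| ≤ Kp k y * N * ℓ k j ^ 5 * Real.exp (-(κ * C.d x)) *
        Real.exp (-(1 / 8) * (κ₁ - 1) * P.dY k y + (1 / 8) * κ₁ * d0 - (1 / 2) * (κ₁ - 1) * P.vol k y a b)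

/-- **THE LEVEL COUNTS of [II] p. 8, per creation step** (binders, the paper's numerals not verified here — exactly the
hypotheses `hX`, `hq`, `hY`, `h0` of `B13Sect1Arith.gather_129`): the □′-cover of the sources (p. 8 l. 1–4: every source
X ∈ 𝐃_j, X ⊂ □̃² contains some □′ ∈ π_j, □′ ⊂ □̃²), (1.26) *"Σ_{X∈𝐃_j,X⊃□′} exp(−κd_j(X)) ≦ O(1)"*, the □′-count *"This yields
(6L)⁴L^jη"*, (1.27) *"The sum is bounded by exp(8·12³exp(−½(κ₁−1))) ≦ e"*, (1.28) *"M⁻⁴|Y| ≦ 3·2³d_k(Y) ≦ exp(1/16)(κ₁−2)d_k(Y)"*.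
[cite: Balaban1988RG2Cluster, (1.26)-(1.28) p.8] -/
structure LevelCounts (P : PieceData C Bg ι α β γ) (κ κ₁ O1 L : ℝ) (ℓ : ℕ → ℕ → ℝ) : Prop where
  cover : ∀ k y a j, ∀ x ∈ P.src k y a j, ∃ q ∈ P.Sq k y a j, x ∈ P.SX k y a j q
  sumX : ∀ k y a j, ∀ q ∈ P.Sq k y a j, ∑ x ∈ P.SX k y a j q, Real.exp (-(κ * C.d x)) ≤ O1
  countQ : ∀ k y a j, ((P.Sq k y a j).card : ℝ) * ℓ k j ^ 5 ≤ (6 * L) ^ 4 * ℓ k j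
  sumY : ∀ k y, ∀ a ∈ P.S0 k y, ∑ b ∈ P.SY k y a, Real.exp (-(1 / 2) * (κ₁ - 1) * P.vol k y a b) ≤ Real.exp 1
  count0 : ∀ k y, ((P.S0 k y).card : ℝ) ≤ Real.exp ((1 / 16) * (κ₁ - 2) * P.dY k y)

/-- The channel weight of the output index produced by the counting: `Kp·O1·e·exp(⅛κ₁d₀)·exp(−(1/16)κ₁d_k(Y))` — print's
"E₀ε₁O(M^q)exp O(1)κ₁ exp(−(1/16)κ₁d_k(Y))" of (1.29) per unit of E₀, every factor explicit. [cite: Balaban1988RG2Cluster, (1.29) p.8] -/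
def weightOf (P : PieceData C Bg ι α β γ) (κ₁ d0 O1 : ℝ) (Kp : ℕ → ι → ℝ) : ℕ → ι → ℝ :=
  fun k y => Kp k y * O1 * Real.exp 1 * Real.exp ((1 / 8) * κ₁ * d0) * Real.exp (-(1 / 16) * κ₁ * P.dY k y)

/-- The per-creation-step constant produced by the counting: `τ k j = (6L)⁴·ℓ k j` (p. 8 l. 9–10 *"This yields (6L)⁴L^jη"*).
[cite: Balaban1988RG2Cluster, (1.26)-(1.27) p.8] -/
def tauOf (L : ℝ) (ℓ : ℕ → ℕ → ℝ) : ℕ → ℕ → ℝ := fun k j => (6 * L) ^ 4 * ℓ k j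

/-- **THE LEVELS APPLIED TO ONE CREATION STEP OF A PIECE FAMILY**: a nonnegative quantity `g □₀ Y₀ X` attached to the sources
of creation step `j` and bounded there by the (1.24)×(1.25) shape with constant `K` sums, over □₀, Y₀ and the sources, to at
most `K·O1·((6L)⁴·ℓ k j)·e·exp(⅛κ₁d₀)·exp(−(1/16)κ₁d_k(Y))` — the □′-cover (`sum_le_sum_sum_of_cover`) followed by
`gather_atStep`. [folklore] -/
theorem levels_bound (P : PieceData C Bg ι α β γ) {κ κ₁ d0 O1 L K : ℝ} {ℓ : ℕ → ℕ → ℝ}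
    (hL : LevelCounts P κ κ₁ O1 L ℓ) (hK : 0 ≤ K) (hO1 : 0 ≤ O1) (hℓ : ∀ k j, 0 ≤ ℓ k j)
    (k : ℕ) (y : ι) (j : ℕ) (g : α → β → C.Dom → ℝ)
    (hg0 : ∀ a ∈ P.S0 k y, ∀ b ∈ P.SY k y a, ∀ x ∈ P.src k y a j, 0 ≤ g a b x)
    (hg : ∀ a ∈ P.S0 k y, ∀ b ∈ P.SY k y a, ∀ x ∈ P.src k y a j,
      g a b x ≤ K * ℓ k j ^ 5 * Real.exp (-(κ * C.d x)) *
        Real.exp (-(1 / 8) * (κ₁ - 1) * P.dY k y + (1 / 8) * κ₁ * d0 - (1 / 2) * (κ₁ - 1) * P.vol k y a b)) :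
    ∑ a ∈ P.S0 k y, ∑ b ∈ P.SY k y a, ∑ x ∈ P.src k y a j, g a b x
      ≤ K * O1 * ((6 * L) ^ 4 * ℓ k j) * Real.exp 1 * Real.exp ((1 / 8) * κ₁ * d0) *
        Real.exp (-(1 / 16) * κ₁ * P.dY k y) := by
  classical
  -- nonnegative extension of `g` off the sources
  let g' : α → β → C.Dom → ℝ := fun a b x => if x ∈ P.src k y a j then g a b x else 0
  have hg'0 : ∀ a ∈ P.S0 k y, ∀ b ∈ P.SY k y a, ∀ x, 0 ≤ g' a b x := by
    intro a ha b hb x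
    simp only [g']
    split_ifs with h
    · exact hg0 a ha b hb x h
    · exact le_rfl
  -- the □′-cover
  have h1 : ∑ a ∈ P.S0 k y, ∑ b ∈ P.SY k y a, ∑ x ∈ P.src k y a j, g a b x
      ≤ ∑ a ∈ P.S0 k y, ∑ b ∈ P.SY k y a, ∑ q ∈ P.Sq k y a j, ∑ x ∈ P.SX k y a j q, g' a b x := by
    refine Finset.sum_le_sum fun a ha => Finset.sum_le_sum fun b hb => ?_
    have he : ∑ x ∈ P.src k y a j, g a b x = ∑ x ∈ P.src k y a j, g' a b x :=
      Finset.sum_congr rfl fun x hx => by simp only [g', if_pos hx]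
    rw [he]
    exact sum_le_sum_sum_of_cover _ _ _ _ (hg'0 a ha b hb) (hL.cover k y a j)
  -- `gather_atStep`
  have h2 := gather_atStep (P.S0 k y) (P.SY k y) (fun a _ => P.Sq k y a j) (fun a _ q => P.SX k y a j q)
    (fun a b _ x => g' a b x) (ℓ k j) C.d (P.vol k y) (K := K) (O1 := O1) (L := L) (d := P.dY k y)
    (d0 := d0) (κ := κ) (κ₁ := κ₁) hK hO1 (hℓ k j)
    (fun a ha b hb q _ x _ => by
      simp only [g']
      split_ifs with h
      · exact hg a ha b hb x h
      · exact mul_nonneg (mul_nonneg (mul_nonneg hK (pow_nonneg (hℓ k j) 5)) (Real.exp_pos _).le)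
          (Real.exp_pos _).le)
    (fun a _ b _ q hq => hL.sumX k y a j q hq) (fun a _ b _ => hL.countQ k y a j) (hL.sumY k y) (hL.count0 k y)
  exact h1.trans h2

/-- The step-j block of a family of size `N·e^{−κd}` at scale j is bounded by `weightOf · (tauOf · N)` — `levels_bound`
applied to the absolute values of the pieces, with the displayed `PieceBound`. [folklore] -/
theorem abs_stepBlock_le {P : PieceData C Bg ι α β γ} {κ κ₁ d0 O1 L : ℝ} {Kp : ℕ → ι → ℝ} {ℓ : ℕ → ℕ → ℝ}
    (hsrc : SrcScale P) (hPiece : PieceBound P κ κ₁ d0 Kp ℓ) (hL : LevelCounts P κ κ₁ O1 L ℓ)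
    (hKp : ∀ k y, 0 ≤ Kp k y) (hO1 : 0 ≤ O1) (hℓ : ∀ k j, 0 ≤ ℓ k j) (k j : ℕ) (s : ℕ → ℝ) (y : ι)
    {H : Bg → C.Dom → ℝ} {N : ℝ} (hN : 0 ≤ N)
    (hbd : ∀ (U : Bg) (X : C.Dom), C.scale X = j → |H U X| ≤ Real.exp (-(κ * C.d X)) * N) :
    |stepBlock P k s H y j| ≤ weightOf P κ₁ d0 O1 Kp k y * (tauOf L ℓ k j * N) := by
  have h1 : |stepBlock P k s H y j| ≤ ∑ a ∈ P.S0 k y, ∑ b ∈ P.SY k y a,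
      ∑ x ∈ P.src k y a j, |P.piece k s y a b x (fun U => H U x)| := by
    simp only [stepBlock]
    refine (Finset.abs_sum_le_sum_abs _ _).trans (Finset.sum_le_sum fun a _ => ?_)
    refine (Finset.abs_sum_le_sum_abs _ _).trans (Finset.sum_le_sum fun b _ => ?_)
    exact Finset.abs_sum_le_sum_abs _ _
  have h2 := levels_bound P hL (mul_nonneg (hKp k y) hN) hO1 hℓ k y j
    (fun a b x => |P.piece k s y a b x (fun U => H U x)|) (fun a _ b _ x _ => abs_nonneg _)
    (fun a ha b hb x hx =>
      hPiece k s y a ha b hb j x hx (fun U => H U x) N hN (fun U => hbd U x (hsrc k y a j x hx)))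
  calc |stepBlock P k s H y j| ≤ _ := h1
    _ ≤ Kp k y * N * O1 * ((6 * L) ^ 4 * ℓ k j) * Real.exp 1 * Real.exp ((1 / 8) * κ₁ * d0) *
          Real.exp (-(1 / 16) * κ₁ * P.dY k y) := h2
    _ = weightOf P κ₁ d0 O1 Kp k y * (tauOf L ℓ k j * N) := by
        simp only [weightOf, tauOf]; ring

/-- **LEAF S5 FOR THE PIECE FORM (the point of the module)**: a channel of the printed (1.23)/(1.33)-piece form whose pieces
obey the displayed (1.24)×(1.25) bound `PieceBound` and whose index families obey the level counts of [II] p. 8 satisfies the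
NE9 frame's per-creation-step size binder `ChannelSizeAtStepNN Adm (pieceChannel P) κ wt τ` — on ANY class `Adm` — with
`wt = weightOf P κ₁ d₀ O1 Kp` (print's (1.29) weight per unit of E₀) and **`τ k j = (6L)⁴·ℓ k j`** (p. 8 l. 9–10, the factor
L^jη KEPT).  One input family, one history: the fading SOURCE, not NE9. [cite: Balaban1988RG2Cluster, (1.24)-(1.29) pp.7-8, (1.36) p.9] -/
theorem channelSizeAtStepNN_piece {P : PieceData C Bg ι α β γ} {κ κ₁ d0 O1 L : ℝ} {Kp : ℕ → ι → ℝ} {ℓ : ℕ → ℕ → ℝ}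
    (hsrc : SrcScale P) (hPiece : PieceBound P κ κ₁ d0 Kp ℓ) (hL : LevelCounts P κ κ₁ O1 L ℓ)
    (hKp : ∀ k y, 0 ≤ Kp k y) (hO1 : 0 ≤ O1) (hℓ : ∀ k j, 0 ≤ ℓ k j) (Adm : Set (Bg → C.Dom → ℝ)) :
    ChannelSizeAtStepNN Adm (pieceChannel P) κ (weightOf P κ₁ d0 O1 Kp) (tauOf L ℓ) := by
  intro k j hjk s H _ hsupp N hN hbd y
  rw [pieceChannel_of_supported hsrc hjk s hsupp y]
  exact abs_stepBlock_le hsrc hPiece hL hKp hO1 hℓ k j s y hN hbd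

/-! ## §3 The PROFILE: `ℓ k j = L^jη = L^j·(L^k)⁻¹` gives `τ k j = (6L)⁴·(L⁻¹)^{k−j}` — the END's `hτ`, `hω` -/

/-- Print's per-step factor with η = L^{−k}: `ℓ k j = L^jη = L^j·(L^k)⁻¹` (the letters of `B13Sect1Arith.jsum_le`).
[cite: Balaban1988RG2Cluster, (1.24) p.7] -/
def ellPrinted (L : ℝ) : ℕ → ℕ → ℝ := fun k j => L ^ j * (L ^ k)⁻¹

/-- `L^j·(L^k)⁻¹ = (L⁻¹)^{k−j}` for `j ≤ k`, `L ≠ 0`. [folklore] -/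
theorem ellPrinted_eq_pow {L : ℝ} (hL : L ≠ 0) {k j : ℕ} (hjk : j ≤ k) :
    ellPrinted L k j = L⁻¹ ^ (k - j) := by
  simp only [ellPrinted]
  obtain ⟨m, rfl⟩ := Nat.exists_eq_add_of_le hjk
  rw [Nat.add_sub_cancel_left, pow_add, mul_inv, ← mul_assoc, mul_inv_cancel₀ (pow_ne_zero _ hL), one_mul, inv_pow]

/-- `0 ≤ ellPrinted L k j` for `0 ≤ L`. [folklore] -/
theorem ellPrinted_nonneg {L : ℝ} (hL : 0 ≤ L) (k j : ℕ) : 0 ≤ ellPrinted L k j :=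
  mul_nonneg (pow_nonneg hL _) (inv_nonneg.mpr (pow_nonneg hL _))

/-- `ellPrinted L k j ≤ 1` for `j ≤ k`, `1 ≤ L` (L^jη ≤ 1: the creation scale is at most the current unit). [folklore] -/
theorem ellPrinted_le_one {L : ℝ} (hL : 1 ≤ L) {k j : ℕ} (hjk : j ≤ k) : ellPrinted L k j ≤ 1 := by
  rw [ellPrinted_eq_pow (by linarith) hjk]
  exact pow_le_one₀ (inv_nonneg.mpr (by linarith)) (inv_le_one_of_one_le₀ hL)

/-- **THE GEOMETRIC PROFILE**: with the printed factor, `τ k j = (6L)⁴·(L⁻¹)^{k−j}` for `j ≤ k` — EXACTLY the END's profile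
binder `hτ : τ k j ≤ τ̄·ω^{k−j}` with `τ̄ = (6L)⁴`, `ω = L⁻¹` (equality). [folklore] -/
theorem tau_eq_geometric {L : ℝ} (hL : L ≠ 0) {k j : ℕ} (hjk : j ≤ k) :
    tauOf L (ellPrinted L) k j = (6 * L) ^ 4 * L⁻¹ ^ (k - j) := by
  simp only [tauOf, ellPrinted_eq_pow hL hjk]

/-- **THE END's PROFILE BINDERS DISCHARGED FOR THE PIECE FORM**: `∀ k j, j ≤ k → τ k j ≤ τ̄·ω^{k−j}` with `τ̄ = (6L)⁴`,
`ω = L⁻¹`, together with `0 ≤ ω`, `ω < 1` (L > 1) and `0 ≤ τ̄` — the shape of the binders `hτ`, `hω`, `hτbar` of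
`NE9LastCouplingBridge.ne9_and_fadingMemory_of_couplingTwoPoint` and its faces (the memory then fades iff
`L⁻¹ + (feedback gain) < 1`, `T4HistoryLipschitzSegment.fade_iff`). [folklore] -/
theorem profile_of_pieceForm {L : ℝ} (hL : 1 < L) :
    (∀ k j : ℕ, j ≤ k → tauOf L (ellPrinted L) k j ≤ (6 * L) ^ 4 * L⁻¹ ^ (k - j)) ∧
      0 ≤ L⁻¹ ∧ L⁻¹ < 1 ∧ 0 ≤ (6 * L) ^ 4 :=
  ⟨fun _ _ hjk => (tau_eq_geometric (by linarith) hjk).le, inv_nonneg.mpr (by linarith),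
    inv_lt_one_of_one_lt₀ hL, by positivity⟩

/-- **PRINT's j-SUMMED CONSTANT**: `Σ_{j≤k} τ k j ≤ 2(6L)⁴` for `L ≥ 2` (*"and the sum over j is bounded by 2(6L)⁴"*, p. 8;
kernel `B13Sect1Arith.jsum_le`) — what Lemma 1's STATEMENT (1.36) retains after the sum over the creation steps; the
per-step profile above is what it forgets (record census E37). [cite: Balaban1988RG2Cluster, (1.27) p.8] -/
theorem sum_tau_le {L : ℝ} (hL : 2 ≤ L) (k : ℕ) :
    ∑ j ∈ Finset.range (k + 1), tauOf L (ellPrinted L) k j ≤ 2 * (6 * L) ^ 4 := by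
  simpa only [tauOf, ellPrinted] using B13Sect1Arith.jsum_le hL k

/-- The S5 leaf with the printed factor, packaged: size binder + profile (`τ̄ = (6L)⁴`, `ω = L⁻¹ < 1`). [folklore] -/
theorem channelSizeAtStepNN_piece_printed {P : PieceData C Bg ι α β γ} {κ κ₁ d0 O1 L : ℝ} {Kp : ℕ → ι → ℝ}
    (hL1 : 1 < L) (hsrc : SrcScale P) (hPiece : PieceBound P κ κ₁ d0 Kp (ellPrinted L))
    (hLev : LevelCounts P κ κ₁ O1 L (ellPrinted L)) (hKp : ∀ k y, 0 ≤ Kp k y) (hO1 : 0 ≤ O1)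
    (Adm : Set (Bg → C.Dom → ℝ)) :
    ChannelSizeAtStepNN Adm (pieceChannel P) κ (weightOf P κ₁ d0 O1 Kp) (tauOf L (ellPrinted L)) ∧
      (∀ k j : ℕ, j ≤ k → tauOf L (ellPrinted L) k j ≤ (6 * L) ^ 4 * L⁻¹ ^ (k - j)) ∧ 0 ≤ L⁻¹ ∧ L⁻¹ < 1 :=
  ⟨channelSizeAtStepNN_piece hsrc hPiece hLev hKp hO1 (fun k j => ellPrinted_nonneg (by linarith) k j) Adm,
    (profile_of_pieceForm hL1).1, (profile_of_pieceForm hL1).2.1, (profile_of_pieceForm hL1).2.2.1⟩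

end Summit.QuantumFields.BalabanUV.T4Continuum.NE9Lemma1Counting
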